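import Literature.MathematicalPhysics.QuantumFieldTheory.Balaban1983to89.B9SectBGReadCodedQY

/-!
# Balaban [B9], Thm 3.4 p. 400 ∕ Thm 3.3 p. 399 ∕ (3.43) p. 398 at a GENERIC averaging pair `(𝔮, 𝔮s)` — the (3.43) Hölder-transfer of the bond-sector
# frame PROVED for `KACU` at the letter `G[𝔮] := GAQY 𝔮 𝔮s par (GpY par)` (CASCADE-K piece «K2-G», stage B2; the `G[𝔮]`-edition of
# `B9SectBH1GProbesY` §Bridges and of `B9SectBCodedChainR4`'s `B9SectBH1GFrameCodedYR.h1G_transfer_KACU`)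

T. Bałaban, *Propagators for lattice gauge theories in a background field*, Commun. Math. Phys. **99** (1985) 389–434
[`Balaban1985BackgroundPropagators`, "B9"]; [4] = T. Bałaban, *Propagators and renormalization transformations for lattice gauge theories. II*,
Commun. Math. Phys. **96** (1984) 223–250 [`Balaban1984PropagatorsII`]; [B8] = T. Bałaban, *Averaging operations for lattice gauge theories*,
Commun. Math. Phys. **98** (1985) 17–51 [`Balaban1985Averaging`].

statement-level skeleton of published theorems with citation tags; proofs where landed; nothing here is a claim about the
Yang–Mills mass gap

THE PRINTED LOCUS.  (3.43) p. 398: *«|(ζ∇_U Gλ)(b)|, |(ζG∇*_Uλ)(b)| ≦ B₀(β)(Lʲη)^{1−β}‖ζ‖_{β}e^{−δd(y,y′)}‖λ‖»* for `G(U) = Δ_a(U)⁻¹` (Thm 3.3 p. 399), transferred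
to `G(U′U)` in Sect. B ((3.82)–(3.86) p. 407, p. 403 l.1–9) — for the averaging operation `Q(U)` of (3.11)–(3.13) p. 392 = [B8] Prop. 2 p. 26.

WHY THIS FILE (seat dag-n06-c gen 25; cell INBOX 2026-08-30 «⚑ K2-G SCOPE», stage B2; node00-def-Y RULING I.20106).  The landed transfer
`B9SectBH1GFrameCodedYR.h1G_transfer_KACU` (CASCADE-R edition of gen 14's proof) is stated for `KACU P G x (GAY par parB (GpY par)) parB C37 C38` and the
coded letter `GbC`; its proof reads the letter only through the probe bridges `lamB_GbC ∕ lamB_DL_GbC ∕ lamB_GbC_DR ∕ lamB_GbC_DF` (`B9SectBH1GProbesY`) and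
the OA-generic readers of `KACU`.  THIS FILE is the same text at `G[𝔮]`: §1 the four bridges for `GbQC` (`lamB_GbQC`, `lamB_DL_GbQC`, `lamB_GbQC_DR`,
`lamB_GbQC_DF` — proofs verbatim via `GbQC_eq_conj_bondOpCoordsRY`); §2 ★★ `h1G_transfer_KACUQ` — `h1G_transfer_KACU` VERBATIM with `GAY ↦ GAQY 𝔮 𝔮s`,
`GbC ↦ GbQC 𝔮 𝔮s` (binders: `(𝔮, 𝔮s)` inserted after the member `x`; at `(QY parB, QsY parB)` it IS the parent, `rfl` faces of `B9SectBGWordDeltaAQY` §4).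

HONEST SCOPE.  Mechanical re-press of a kernel-checked proof; the (3.42)∕(3.43) blocks at the base, the bond Hölder law `HolderLipBY` and r06's per-probe
transfers `HL ∕ HR` are HYPOTHESES as in the parent; nothing of [B9] asserted; count-neutral; N06 NOT discharged; nothing continuum ∕ OS ∕ mass-gap ∕ Clay.
0 `def`, 0 `sorry`.  `--supports stmt-QuantumFields-27364`.

RELATED IN THE TREE, NOT DUPLICATED: `B9SectBH1GProbesY` (probes, USED), `B9SectBCodedChainR4` ∕ `B9SectBH1GFrameCodedY` (the `QY` editions and their
letter-free tools `wHG6`, `probeBC`, …, USED), `B9SectBGReadCodedQY` ∕ `B9SectBGWordDeltaAQY` (stages A∕B1).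
-/

noncomputable section

namespace Literature.MathematicalPhysics.QuantumFieldTheory.Balaban1983to89.B9SectBH1GTransferQY

open Literature.MathematicalPhysics.QuantumFieldTheory.Balaban1983to89.B9SectBCodedClassR (RegExtraY bg9YC)
open Literature.MathematicalPhysics.QuantumFieldTheory.Balaban1983to89.B9SectBH1GFrameCodedY hiding h1G_transfer_KACU h1GFrame₆CodedOn stepH1Pos_KACU_frame_on

open LatticeFieldCalculus (supDist)
open B9Eq39Adjoint (R R_smul R_zero R_sub R_add)
open B6GlobalChartV1 (PV blkV1 boxEquiv)
open B6Geom246MultiLevelTorus (geomT)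
open B6Ineq2142KLevelV1 (β beta_level)
open B6KLevelCensusIndexV1 (KIdx Adm kGeo)
open B6RandomWalk (HasMajorant hasMajorant_mono BlockSupp Ineq261)
open B9Thm34Ext (toB6)
open B9FromB6 (EBlock H1Block)
open B9GeoNormsKLevelV1 (geo9K geo9K_dist_nonneg)
open B9GeoLemma21KLevelV1 (geo9Y_dist_comm geo9Y_dist_triangle geo9Y_len_pos one_le_k)
open B9Eq310Hermitian (norm_R_le)
open B9Eq352DivFormLetters (conj coordEquiv conj_mul)
open B9Eq352GradLetters (diffLetter)
open B9Eq371GradLetters (bT bU)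
open B9CoReadingCoords (cdBₗ cdsBₗ cdBₗ_apply cdsBₗ_apply)
open B9PinMembersKLevelV1 (MemberY geo9Y bg9Y)
open B9Eq360DeltaPrimeAY (AfldY)
open B9SectBGpLettersY (GVal decY decY_base blkC coordC norm_le_one_and_inv_of_mem)
open B9SectBL2DictionaryY (coordC_base_eq)
open B9SectBGpFrameCodedYR (codingYx)
open B9SectBGpFrameCodedY (CplxLettersY)
open B9SectBGpReadingsYR (KSC)
open B9SectBGpReadingsY (baseY)
open B9SectBCodedCarrier (CCfg pullS)
open B9SectBCodedReadingsUR (KACU)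
open B9SectBKerFrameCodedYR (CinvY)
open B9SectBStepWhole (StepPos StepH1Pos)
open B9RWSumsReadsNbr (nbr mem_nbr)
open B9RWSumsCompleteGeo9YNbr (len_le_of_dist_lt_M_geo9K)
open B9GeoNormsKLevelModelSignsV1 (modelSignsOn_geo9K)
open Node00 (SiteY BlkY FBondY IBondY CfgY BallY SiteParY BondParY BondOpY liftY liftY_apply holderQB cdB cdsB UboxY shiftY GAQY GpY XY deltaAQY deltaPrimeAY
  bondCoordsY bondFunCoordsY)
open B9SectBGWordDeltaAY (bondOpCoordsRY GbC)
open B9SectBGReadCodedY (eta_inv_eq_abs_cf hasMajorant_of_eq hasMajorant_conj_bondOpCoordsRY GbC_eq_conj_bondOpCoordsRY bondOpCoordsRY_mul)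
open B9SectBGReadYR (readG342Y_KACU)
open B9SectBGFrameCodedYR (gFrame₅CodedOn)
open B9SectBGFrameCodedY (cXY cXY_nonneg parB_contractive)
open B9SectBGClassLettersY (Reg335PlaqY CplxLettersGY VarParBY)
open B9SectBH1GFrameV6 (H1GFrame₆ stepH1Pos_of_h1GFrame₆)
open B9SectBH1GReadWriteYR (KACU_h1_inr_eq KACU_h1_off)
open B9SectBH1GReadWriteY (probeB norm_probeB norm_probeB_neg h1ReadB h1ReadB_le_of_probes probeB_apply)
open B9SectBH1GProbesY (lamB lamB_GbC lamB_DL_GbC lamB_GbC_DR lamB_GbC_DF lamB_conj_bondOpCoordsRY lamB_coordEquiv_bondFunCoordsY norm_map_symm_mul_diffLetter_inr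
  norm_map_symm_mul_diffLetter_inl probeBC probeBC_symm blockSupp_coordEquiv_bondFun_liftY probeL_lamB_le probeR_lamB_le norm_lamB_le_of_hasMajorant
  probe_crossB_lamB_le)
open B9SectBH1GUndiffY (HolderLipBY lenB lenB_pos probeB_undiff_le cutH_inr_nonneg)

open B9SectBGWordDeltaAQY (GbQC)
open B9SectBGReadCodedQY (GbQC_eq_conj_bondOpCoordsRY)

variable {d ℓ : ℕ} {hd : 1 ≤ d + 1} {hL : Odd (ℓ + 1) ∧ 1 < ℓ + 1} {b₀ b₁ : ℝ} {Mstar : ℕ}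
variable {𝔸 : Type} [NormedRing 𝔸] (P : RegExtraY d ℓ hd hL b₀ b₁ Mstar 𝔸) [NormedAlgebra ℂ 𝔸] [CompleteSpace 𝔸]

/-! ## §1 The probe bridges for the letter `GbQC` -/

section Bridges

variable {ι : Type} [Fintype ι] (x : MemberY d ℓ hd hL b₀ b₁ Mstar)
  (𝔮 : CfgY 𝔸 x.toKIdx → ((FBondY x.toKIdx → 𝔸) →ₗ[ℂ] (IBondY x.toKIdx → 𝔸)))
  (𝔮s : CfgY 𝔸 x.toKIdx → ((IBondY x.toKIdx → 𝔸) →ₗ[ℂ] (FBondY x.toKIdx → 𝔸))) (parS : SiteParY 𝔸 x.toKIdx) (b : Module.Basis ι ℝ 𝔸)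

/-- ★ BRIDGE 0 (`G` itself): `lamB (GbQC c μ) = G(dec c)(lamB μ)` with `G := GAQY 𝔮 𝔮s parS (GpY parS)`. [cite: Balaban1985BackgroundPropagators, (3.27) p.395, Thm 3.3 p.399; Balaban1984PropagatorsII, (2.51) p.232] -/
theorem lamB_GbQC (c : CCfg (CfgY 𝔸 x.toKIdx) (AfldY 𝔸 x.toKIdx)) (μ : (Fin (d + 1) × SiteY x.toKIdx) × ι → ℝ) :
    lamB x.toKIdx b (GbQC x.toKIdx 𝔮 𝔮s parS b c μ) = GAQY x.toKIdx 𝔮 𝔮s parS (GpY x.toKIdx parS) (decY x.toKIdx c) (lamB x.toKIdx b μ) := by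
  rw [GbQC_eq_conj_bondOpCoordsRY, lamB_conj_bondOpCoordsRY]; rfl

/-- ★ BRIDGE L (the printed left word): `lamB ((conj b (cdBₗ̂ U ν) * GbC c) μ) = ∇_{U,ν}(G(dec c)(lamB μ))`.
[cite: Balaban1985BackgroundPropagators, (3.43) p.398 («ζ∇_U Gλ»), (3.3) p.390; Balaban1984PropagatorsII, (2.51)–(2.52) p.232] -/
theorem lamB_DL_GbQC (U : CfgY 𝔸 x.toKIdx) (ν : Fin (d + 1)) (c : CCfg (CfgY 𝔸 x.toKIdx) (AfldY 𝔸 x.toKIdx))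
    (μ : (Fin (d + 1) × SiteY x.toKIdx) × ι → ℝ) :
    lamB x.toKIdx b ((conj b (bondOpCoordsRY x.toKIdx (cdBₗ x.toKIdx U ν)) * GbQC x.toKIdx 𝔮 𝔮s parS b c) μ) =
      cdB x.toKIdx U ν (GAQY x.toKIdx 𝔮 𝔮s parS (GpY x.toKIdx parS) (decY x.toKIdx c) (lamB x.toKIdx b μ)) := by
  rw [Module.End.mul_apply, lamB_conj_bondOpCoordsRY, lamB_GbQC]; rfl

/-- ★ BRIDGE R (the printed right word): `lamB ((GbQC c * conj b (cdsBₗ̂ U ν)) μ) = G(dec c)(∇*_{U,ν}(lamB μ))`.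
[cite: Balaban1985BackgroundPropagators, (3.43) p.398 («ζG∇*_Uλ»), (3.8) p.392; Balaban1984PropagatorsII, (2.51)–(2.52) p.232] -/
theorem lamB_GbQC_DR (U : CfgY 𝔸 x.toKIdx) (ν : Fin (d + 1)) (c : CCfg (CfgY 𝔸 x.toKIdx) (AfldY 𝔸 x.toKIdx))
    (μ : (Fin (d + 1) × SiteY x.toKIdx) × ι → ℝ) :
    lamB x.toKIdx b ((GbQC x.toKIdx 𝔮 𝔮s parS b c * conj b (bondOpCoordsRY x.toKIdx (cdsBₗ x.toKIdx U ν))) μ) =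
      GAQY x.toKIdx 𝔮 𝔮s parS (GpY x.toKIdx parS) (decY x.toKIdx c) (cdsB x.toKIdx U ν (lamB x.toKIdx b μ)) := by
  rw [Module.End.mul_apply, lamB_GbQC, lamB_conj_bondOpCoordsRY]; rfl

/-- BRIDGE R′ (the right-forward cross word): `lamB ((GbQC c * conj b (cdBₗ̂ U ν)) μ) = G(dec c)(∇_{U,ν}(lamB μ))`.
[cite: Balaban1985BackgroundPropagators, (3.3) p.390, (3.42) p.397 (not a printed orientation); Balaban1984PropagatorsII, (2.51)–(2.52) p.232] -/
theorem lamB_GbQC_DF (U : CfgY 𝔸 x.toKIdx) (ν : Fin (d + 1)) (c : CCfg (CfgY 𝔸 x.toKIdx) (AfldY 𝔸 x.toKIdx))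
    (μ : (Fin (d + 1) × SiteY x.toKIdx) × ι → ℝ) :
    lamB x.toKIdx b ((GbQC x.toKIdx 𝔮 𝔮s parS b c * conj b (bondOpCoordsRY x.toKIdx (cdBₗ x.toKIdx U ν))) μ) =
      GAQY x.toKIdx 𝔮 𝔮s parS (GpY x.toKIdx parS) (decY x.toKIdx c) (cdB x.toKIdx U ν (lamB x.toKIdx b μ)) := by
  rw [Module.End.mul_apply, lamB_GbQC, lamB_conj_bondOpCoordsRY]; rfl

end Bridges

/-! ## §2 ★★ The transfer field of the (3.43) frame PROVED for `KACU` at `G[𝔮]` -/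

section Transfer


variable [NormOneClass 𝔸] (c35 : ℝ) (G : Subgroup 𝔸ˣ) (x : MemberY d ℓ hd hL b₀ b₁ Mstar)
  (𝔮 : CfgY 𝔸 x.toKIdx → ((FBondY x.toKIdx → 𝔸) →ₗ[ℂ] (IBondY x.toKIdx → 𝔸)))
  (𝔮s : CfgY 𝔸 x.toKIdx → ((IBondY x.toKIdx → 𝔸) →ₗ[ℂ] (FBondY x.toKIdx → 𝔸))) (par : SiteParY 𝔸 x.toKIdx) (parB : BondParY 𝔸 x.toKIdx)
  {ι : Type} [Fintype ι] (b : Module.Basis ι ℝ 𝔸) (ιB : BlkY x.toKIdx → IBondY x.toKIdx) [Fintype (geo9Y x).Site]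
  (C37 C38 : ℝ → CfgY 𝔸 x.toKIdx → AfldY 𝔸 x.toKIdx → Prop)

set_option maxHeartbeats 1600000 in
/-- ★★ **THE TRANSFER FIELD OF THE (3.43) BOND-SECTOR FRAME, PROVED FOR `KACU` AT def-Y's LETTERS** (see the module header for the proof plan): from r06's per-probe
left and right Hölder transfers for the letter `GbQC` of the member (hypotheses `HL`, `HR`, the shapes of `H1GFrame₆.h1G_transfer`), the (3.42)∕(3.43) blocks of
`KACU` at the base, the bond transporter law `HolderLipBY` at the regular base and the neighbour count, the (3.43) block of `KACU` at the coded product with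
`(wHG6 … B₀ B δc Bβ, δc∕6)`.
[cite: Balaban1985BackgroundPropagators, Thm 3.4 p.400, Thm 3.3 p.399, (3.43) p.398, (3.40) p.397, p.403 l.1–9, (3.82)–(3.86) p.407; Balaban1984PropagatorsII, (2.51)–(2.52) p.232, Lemma 2.1 p.234, (2.60) p.234] -/
theorem h1G_transfer_KACUQ (hι : ∀ s : BlkY x.toKIdx, β x.toKIdx.hN x.toKIdx.D x.toKIdx.hk (ιB s) = s)
    (hG1 : ∀ u : 𝔸ˣ, u ∈ G → ‖(u : 𝔸)‖ ≤ 1) (hparB : ∀ U : CfgY 𝔸 x.toKIdx, GVal G x.toKIdx U → ∀ s s', parB U s s' ∈ G)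
    {M₂ : ℝ} (hM₂ : 0 ≤ M₂) (hrepr : ∀ (v : 𝔸) (j : ι), |b.repr v j| ≤ M₂ * ‖v‖)
    {cLip rL : ℝ} (hcLip : 0 ≤ cLip) (hrL : 0 ≤ rL)
    (hLipB : ∀ (α₀ : ℝ) (U : CfgY 𝔸 x.toKIdx), (bg9YC 𝔸 G P x).Reg335 c35 α₀ U → HolderLipBY x.toKIdx cLip rL (parB U) U)
    {MInv : ℝ} {mN : ℕ} (hnbr : MInv ≤ (geo9Y x).M → ∀ y' : IBondY x.toKIdx, (nbr (geo9Y x) (2 * ((d : ℝ) + 1)) y').card ≤ mN)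
    (hMr : rL + 1 < MInv) (cRG : ℝ → ℝ) {aInv aW : ℝ}
    (α₀ : ℝ) (c c' : (codingYx P G x C37 C38).bg.Cfg) (α₁ B₀ B δ δc : ℝ) (Bβ : ℝ → ℝ)
    (hM : MInv ≤ (geo9Y x).M) (_hα₀ : 0 < α₀) (_hMa : (geo9Y x).M * α₀ ≤ aInv) (hreg : (codingYx P G x C37 C38).bg.Reg335 c35 α₀ c)
    (_hα₁ : 0 < α₁) (_haW : α₁ ≤ aW) (h37 : (codingYx P G x C37 C38).bg.Cplx337 α₁ c c') (hB₀ : 0 < B₀) (hB : 0 ≤ B)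
    (_hδ : 0 < δ) (hδc : 0 < δc) (hδcδ : δc ≤ δ) (hcRG : M₂ * (∑ j, ‖b j‖) ≤ cRG δ)
    (hE : EBlock (KACU P G x (GAQY x.toKIdx 𝔮 𝔮s par (GpY x.toKIdx par)) parB C37 C38) B₀ δ c)
    (hH1 : H1Block (KACU P G x (GAQY x.toKIdx 𝔮 𝔮s par (GpY x.toKIdx par)) parB C37 C38) Bβ δ c)
    (HL : ∀ (D : Module.End ℝ ((Fin (d + 1) × SiteY x.toKIdx) × ι → ℝ)) (Φ : (Fin (d + 1) × SiteY x.toKIdx → 𝔸) →ₗ[ℝ] 𝔸) (y : IBondY x.toKIdx)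
      (p₀ : (Fin (d + 1) × SiteY x.toKIdx) × ι), blkC x.toKIdx ιB p₀.1.2 = y → ∀ (β' Bh cζ : ℝ), 0 ≤ Bh → 0 ≤ cζ →
        (∀ (y' : IBondY x.toKIdx) (μ : (Fin (d + 1) × SiteY x.toKIdx) × ι → ℝ) (M : ℝ),
          BlockSupp (g := toB6 (geo9Y x) (0 : ℝ) True) (fun q : (Fin (d + 1) × SiteY x.toKIdx) × ι => blkC x.toKIdx ιB q.1.2) μ y' M →
          ‖Φ ((coordEquiv b).symm (D (GbQC x.toKIdx 𝔮 𝔮s par b c μ)))‖ ≤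
            Bh * (geo9Y x).len y ^ (1 - β') * cζ * Real.exp (-(δc * (geo9Y x).dist y y')) * M) →
        ∀ (y' : IBondY x.toKIdx) (μ : (Fin (d + 1) × SiteY x.toKIdx) × ι → ℝ) (M : ℝ),
          BlockSupp (g := toB6 (geo9Y x) (0 : ℝ) True) (fun q : (Fin (d + 1) × SiteY x.toKIdx) × ι => blkC x.toKIdx ιB q.1.2) μ y' M →
          ‖Φ ((coordEquiv b).symm (D (GbQC x.toKIdx 𝔮 𝔮s par b ((codingYx P G x C37 C38).bg.mul c' c) μ)))‖ ≤
            B * Bh * (geo9Y x).len y ^ (1 - β') * cζ * Real.exp (-(δc / 6 * (geo9Y x).dist y y')) * M)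
    (HR : ∀ (Ds : Module.End ℝ ((Fin (d + 1) × SiteY x.toKIdx) × ι → ℝ)),
      HasMajorant (g := toB6 (geo9Y x) (0 : ℝ) True) (fun q : (Fin (d + 1) × SiteY x.toKIdx) × ι => blkC x.toKIdx ιB q.1.2)
        (GbQC x.toKIdx 𝔮 𝔮s par b c * Ds) (fun a a' => cRG δ * B₀ * (geo9Y x).len a * Real.exp (-(δc * (geo9Y x).dist a a'))) →
      ∀ (Φ : (Fin (d + 1) × SiteY x.toKIdx → 𝔸) →ₗ[ℝ] 𝔸) (y : IBondY x.toKIdx) (p₀ : (Fin (d + 1) × SiteY x.toKIdx) × ι),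
      blkC x.toKIdx ιB p₀.1.2 = y → ∀ (γ Bh cζ : ℝ), 0 ≤ Bh → 0 ≤ cζ →
        (∀ (y' : IBondY x.toKIdx) (μ : (Fin (d + 1) × SiteY x.toKIdx) × ι → ℝ) (M : ℝ),
          BlockSupp (g := toB6 (geo9Y x) (0 : ℝ) True) (fun q : (Fin (d + 1) × SiteY x.toKIdx) × ι => blkC x.toKIdx ιB q.1.2) μ y' M →
          ‖Φ ((coordEquiv b).symm (GbQC x.toKIdx 𝔮 𝔮s par b c μ))‖ ≤
            Bh * (geo9Y x).len y ^ (2 - γ) * cζ * Real.exp (-(δc * (geo9Y x).dist y y')) * M) →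
        (∀ (k : Fin (d + 1) ⊕ Fin (d + 1)) (y' : IBondY x.toKIdx) (μ : (Fin (d + 1) × SiteY x.toKIdx) × ι → ℝ) (M : ℝ),
          BlockSupp (g := toB6 (geo9Y x) (0 : ℝ) True) (fun q : (Fin (d + 1) × SiteY x.toKIdx) × ι => blkC x.toKIdx ιB q.1.2) μ y' M →
          ‖Φ ((coordEquiv b).symm
              ((GbQC x.toKIdx 𝔮 𝔮s par b c * conj b (diffLetter (bT (shiftY x.toKIdx)) (bU (coordC G x.toKIdx c)) ((((geo9Y x).eta : ℂ))⁻¹) k)) μ))‖ ≤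
            Bh * (geo9Y x).len y ^ (1 - γ) * cζ * Real.exp (-(δc * (geo9Y x).dist y y')) * M) →
        (∀ (y' : IBondY x.toKIdx) (μ : (Fin (d + 1) × SiteY x.toKIdx) × ι → ℝ) (M : ℝ),
          BlockSupp (g := toB6 (geo9Y x) (0 : ℝ) True) (fun q : (Fin (d + 1) × SiteY x.toKIdx) × ι => blkC x.toKIdx ιB q.1.2) μ y' M →
          ‖Φ ((coordEquiv b).symm ((GbQC x.toKIdx 𝔮 𝔮s par b c * Ds) μ))‖ ≤
            Bh * (geo9Y x).len y ^ (1 - γ) * cζ * Real.exp (-(δc * (geo9Y x).dist y y')) * M) →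
        ∀ (y' : IBondY x.toKIdx) (μ : (Fin (d + 1) × SiteY x.toKIdx) × ι → ℝ) (M : ℝ),
          BlockSupp (g := toB6 (geo9Y x) (0 : ℝ) True) (fun q : (Fin (d + 1) × SiteY x.toKIdx) × ι => blkC x.toKIdx ιB q.1.2) μ y' M →
          ‖Φ ((coordEquiv b).symm ((GbQC x.toKIdx 𝔮 𝔮s par b ((codingYx P G x C37 C38).bg.mul c' c) * Ds) μ))‖ ≤
            B * Bh * (geo9Y x).len y ^ (1 - γ) * cζ * Real.exp (-(δc / 6 * (geo9Y x).dist y y')) * M) :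
    H1Block (KACU P G x (GAQY x.toKIdx 𝔮 𝔮s par (GpY x.toKIdx par)) parB C37 C38)
      (wHG6 (2 * ((d : ℝ) + 1)) (((ℓ + 1 : ℕ) : ℝ)) (∑ j, ‖b j‖) M₂ (M₂ * ∑ j, ‖b j‖) cLip rL mN B₀ B δc Bβ) (δc / 6)
      ((codingYx P G x C37 C38).bg.mul c' c) := by
  classical
  letI : Fintype (B9GeoNormsKLevelV1.geo9K x.toKIdx).Site := ‹Fintype (geo9Y x).Site›
  -- the coded pair is (base U, mult a); the product is `prod U a`
  obtain ⟨U, a, rfl, rfl, hCa⟩ := (codingYx P G x C37 C38).exists_of_bg_Cplx337 h37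
  have hU335 : (bg9YC 𝔸 G P x).Reg335 c35 α₀ U := by
    obtain ⟨U', h1, h2⟩ := (codingYx P G x C37 C38).exists_of_bg_Reg335 hreg
    cases h1
    exact h2
  have hU : GVal G x.toKIdx U := hU335.1.1
  -- notation and elementary facts
  set Sb : ℝ := ∑ j, ‖b j‖ with hSb
  have hSb0 : 0 ≤ Sb := Finset.sum_nonneg fun j _ => norm_nonneg _
  set L : ℝ := (((ℓ + 1 : ℕ) : ℝ)) with hLdef
  have hL1 : 1 ≤ L := by rw [hLdef]; exact_mod_cast Nat.succ_le_succ (Nat.zero_le ℓ)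
  have hL0 : 0 ≤ L := le_trans zero_le_one hL1
  set OA : BondOpY 𝔸 x.toKIdx := GAQY x.toKIdx 𝔮 𝔮s par (GpY x.toKIdx par) with hOA
  set TU : (FBondY x.toKIdx → 𝔸) →ₗ[ℂ] (FBondY x.toKIdx → 𝔸) := OA U with hTU
  set TW : (FBondY x.toKIdx → 𝔸) →ₗ[ℂ] (FBondY x.toKIdx → 𝔸) := OA (decY x.toKIdx (.prod U a)) with hTW
  have hco : coordC G x.toKIdx (.base U) = UboxY x.toKIdx U := coordC_base_eq G x hU
  have hη : ((((geo9Y x).eta : ℂ)))⁻¹ = ((|x.toKIdx.cf| : ℝ) : ℂ) := eta_inv_eq_abs_cf x.toKIdx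
  have hDk : ∀ k : Fin (d + 1) ⊕ Fin (d + 1),
      diffLetter (bT (shiftY x.toKIdx)) (bU (coordC G x.toKIdx (.base U))) ((((geo9Y x).eta : ℂ))⁻¹) k =
        diffLetter (bT (shiftY x.toKIdx)) (bU (UboxY x.toKIdx U)) ((|x.toKIdx.cf| : ℝ) : ℂ) k := by
    intro k; rw [hco, hη]
  have hUu : ∀ (ν : Fin (d + 1)) (s : Site (PV d ℓ x.m x.K hd hL) 0),
      ‖((U ν s : 𝔸ˣ) : 𝔸)‖ ≤ 1 ∧ ‖(((U ν s)⁻¹ : 𝔸ˣ) : 𝔸)‖ ≤ 1 := fun ν s => norm_le_one_and_inv_of_mem G hG1 (hU ν s)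
  have hparU : ∀ s s' : Site (PV d ℓ x.m x.K hd hL) 0, ‖((parB U s s' : 𝔸ˣ) : 𝔸)‖ ≤ 1 ∧ ‖(((parB U s s')⁻¹ : 𝔸ˣ) : 𝔸)‖ ≤ 1 :=
    parB_contractive G x parB hG1 (hparB U hU)
  have hLipU : HolderLipBY x.toKIdx cLip rL (parB U) U := hLipB α₀ U hU335
  have hnbrU := hnbr hM
  have hMgeo : rL + 1 < (geo9Y x).M := lt_of_lt_of_le hMr hM
  have hM1 : (1 : ℝ) < (geo9Y x).M := lt_of_le_of_lt (le_add_of_nonneg_left hrL) hMgeo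
  have hdd : 0 ≤ 2 * ((d : ℝ) + 1) := by positivity
  have hdn : ∀ a a' : IBondY x.toKIdx, 0 ≤ (geo9Y x).dist a a' := fun a a' => geo9K_dist_nonneg x.toKIdx a a'
  have hk1 : 1 ≤ x.toKIdx.k := one_le_k x.toKIdx
  have htri := (B6Geom246MultiLevelTorus.triangle_refl_nonneg_T x.toKIdx.D (B9GeoLemma21KLevelV1.one_le_Mh x.toKIdx)
    (B9GeoLemma21KLevelV1.one_le_P x.toKIdx)).1
  -- the (3.42) majorants of the bond letters at the base (def-Y's carrier, rate δ), transported to r06's carrier and lowered to the call rate δc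
  have cR0 : 0 ≤ M₂ * Sb := mul_nonneg hM₂ hSb0
  have hcB : 0 ≤ M₂ * Sb * B₀ := mul_nonneg cR0 hB₀.le
  obtain ⟨g0, g1, g2, -⟩ := readG342Y_KACU P (Rr := 0) (Hp := True) b G x OA parB C37 C38 ιB hι hM₂ hrepr hB₀.le hE
  have lower : ∀ (w : IBondY x.toKIdx → ℝ) (hw : ∀ a, 0 ≤ w a) {T : Module.End ℝ ((Fin (d + 1) × SiteY x.toKIdx) × ι → ℝ)},
      HasMajorant (g := toB6 (geo9Y x) (0 : ℝ) True) (fun q : (Fin (d + 1) × SiteY x.toKIdx) × ι => blkC x.toKIdx ιB q.1.2) T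
        (fun a a' => M₂ * Sb * (B₀ * w a * Real.exp (-(δ * (geo9Y x).dist a a')))) →
      HasMajorant (g := toB6 (geo9Y x) (0 : ℝ) True) (fun q : (Fin (d + 1) × SiteY x.toKIdx) × ι => blkC x.toKIdx ιB q.1.2) T
        (fun a a' => M₂ * Sb * B₀ * w a * Real.exp (-(δc * (geo9Y x).dist a a'))) := by
    intro w hw T h
    refine hasMajorant_mono _ h fun a a' => ?_
    have hexp : Real.exp (-(δ * (geo9Y x).dist a a')) ≤ Real.exp (-(δc * (geo9Y x).dist a a')) :=
      Real.exp_le_exp.2 (by nlinarith [hdn a a'])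
    calc M₂ * Sb * (B₀ * w a * Real.exp (-(δ * (geo9Y x).dist a a'))) = (M₂ * Sb * B₀ * w a) * Real.exp (-(δ * (geo9Y x).dist a a')) := by ring
      _ ≤ (M₂ * Sb * B₀ * w a) * Real.exp (-(δc * (geo9Y x).dist a a')) :=
        mul_le_mul_of_nonneg_left hexp (mul_nonneg hcB (hw a))
  have hm0 : HasMajorant (g := toB6 (geo9Y x) (0 : ℝ) True) (fun q : (Fin (d + 1) × SiteY x.toKIdx) × ι => blkC x.toKIdx ιB q.1.2)
      (conj b (bondOpCoordsRY x.toKIdx (TU.restrictScalars ℝ)))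
      (fun a a' => M₂ * Sb * B₀ * (geo9Y x).len a ^ 2 * Real.exp (-(δc * (geo9Y x).dist a a'))) :=
    lower (fun a => (geo9Y x).len a ^ 2) (fun a => sq_nonneg _) (hasMajorant_conj_bondOpCoordsRY x.toKIdx b ιB _ g0)
  have hm1 : ∀ ν : Fin (d + 1), HasMajorant (g := toB6 (geo9Y x) (0 : ℝ) True) (fun q : (Fin (d + 1) × SiteY x.toKIdx) × ι => blkC x.toKIdx ιB q.1.2)
      (conj b (bondOpCoordsRY x.toKIdx (cdBₗ x.toKIdx U ν ∘ₗ TU.restrictScalars ℝ)))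
      (fun a a' => M₂ * Sb * B₀ * (geo9Y x).len a * Real.exp (-(δc * (geo9Y x).dist a a'))) := fun ν =>
    lower (fun a => (geo9Y x).len a) (fun a => (geo9Y_len_pos x a).le) (hasMajorant_conj_bondOpCoordsRY x.toKIdx b ιB _ (g1 ν))
  have hGbU : GbQC x.toKIdx 𝔮 𝔮s par b (.base U) = conj b (bondOpCoordsRY x.toKIdx (TU.restrictScalars ℝ)) := by
    rw [GbQC_eq_conj_bondOpCoordsRY, decY_base]
  have hm2 : ∀ ν : Fin (d + 1), HasMajorant (g := toB6 (geo9Y x) (0 : ℝ) True) (fun q : (Fin (d + 1) × SiteY x.toKIdx) × ι => blkC x.toKIdx ιB q.1.2)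
      (GbQC x.toKIdx 𝔮 𝔮s par b (.base U) * conj b (bondOpCoordsRY x.toKIdx (cdsBₗ x.toKIdx U ν)))
      (fun a a' => cRG δ * B₀ * (geo9Y x).len a * Real.exp (-(δc * (geo9Y x).dist a a'))) := by
    intro ν
    have h := lower (fun a => (geo9Y x).len a) (fun a => (geo9Y_len_pos x a).le) (hasMajorant_conj_bondOpCoordsRY x.toKIdx b ιB _ (g2 ν))
    have heq : conj b (bondOpCoordsRY x.toKIdx (TU.restrictScalars ℝ ∘ₗ cdsBₗ x.toKIdx U ν)) =
        GbQC x.toKIdx 𝔮 𝔮s par b (.base U) * conj b (bondOpCoordsRY x.toKIdx (cdsBₗ x.toKIdx U ν)) := by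
      rw [hGbU, ← B9Eq352DivFormLetters.conj_mul, ← bondOpCoordsRY_mul]; rfl
    refine hasMajorant_mono _ (hasMajorant_of_eq x.toKIdx heq.symm h) fun a a' => ?_
    have hfac : 0 ≤ B₀ * (geo9Y x).len a * Real.exp (-(δc * (geo9Y x).dist a a')) := mul_nonneg (mul_nonneg hB₀.le (geo9Y_len_pos x a).le) (Real.exp_pos _).le
    calc M₂ * Sb * B₀ * (geo9Y x).len a * Real.exp (-(δc * (geo9Y x).dist a a')) = (M₂ * Sb) * (B₀ * (geo9Y x).len a * Real.exp (-(δc * (geo9Y x).dist a a'))) := by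
          ring
      _ ≤ cRG δ * (B₀ * (geo9Y x).len a * Real.exp (-(δc * (geo9Y x).dist a a'))) := mul_le_mul_of_nonneg_right hcRG hfac
      _ = _ := by ring
  -- the output block
  intro α lam ζ y y' hα0 hα1 hζ hlam
  set W5 : ℝ := wHG6 (2 * ((d : ℝ) + 1)) L Sb M₂ (M₂ * Sb) cLip rL mN B₀ B δc Bβ α with hW5def
  have hW5 : 0 ≤ W5 := wHG6_nonneg mN Bβ hL0 hSb0 hM₂ cR0 hcLip hB₀.le hB α
  have hleny : 0 < (geo9Y x).len y := geo9Y_len_pos x y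
  have hcutH : 0 ≤ (geo9Y x).cutH α ζ := (modelSignsOn_geo9K x.toKIdx).cutH_nonneg α ζ
  have hsupN : 0 ≤ (geo9Y x).supNorm lam := (modelSignsOn_geo9K x.toKIdx).supNorm_nonneg lam
  have hRHS : 0 ≤ W5 * (geo9Y x).len y ^ (1 - α) * (geo9Y x).cutH α ζ * Real.exp (-(δc / 6 * (geo9Y x).dist y y')) * (geo9Y x).supNorm lam :=
    mul_nonneg (mul_nonneg (mul_nonneg (mul_nonneg hW5 (Real.rpow_nonneg hleny.le _)) hcutH) (Real.exp_pos _).le) hsupN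
  -- only (bond argument, bond cut-off) is nontrivial
  rcases lam with f | J
  · rw [(KACU_h1_off P G x OA parB C37 C38 _ α).2 f ζ]; exact hRHS
  rcases ζ with zs | z
  · rw [(KACU_h1_off P G x OA parB C37 C38 _ α).1 J zs]; exact hRHS
  -- the U-letter reading of `G(U′U)` at the base `U`
  rw [KACU_h1_inr_eq]
  show h1ReadB x.toKIdx TW (parB U) U J α z ≤ _
  have hζ' : ∀ q, z q ≠ 0 → (geomT x.toKIdx.D).dist (blkV1 x.toKIdx.hN x.toKIdx.D q) (β x.toKIdx.hN x.toKIdx.D x.toKIdx.hk y) ≤ 1 := hζ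
  -- the anchor: the labelled block of `y`, through a site `w₀` of the block `βy`
  obtain ⟨w₀, hw₀⟩ := B6Geom246MultiLevelBox.exists_blkOf_eq x.toKIdx.D.toDomains (β x.toKIdx.hN x.toKIdx.D x.toKIdx.hk y)
  set y₁ : IBondY x.toKIdx := blkC x.toKIdx ιB w₀ with hy₁
  have hy₁' : y₁ = ιB (β x.toKIdx.hN x.toKIdx.D x.toKIdx.hk y) := by rw [hy₁]; show ιB (B9Eq360DeltaPrimeAY.blkY x.toKIdx w₀) = _; rw [← hw₀]; rfl
  have hy₁β : β x.toKIdx.hN x.toKIdx.D x.toKIdx.hk y₁ = β x.toKIdx.hN x.toKIdx.D x.toKIdx.hk y := by rw [hy₁', hι]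
  have hlen : (geo9Y x).len y₁ = (geo9Y x).len y := Node00.OpsYRead342.geo9K_len_congr x.toKIdx hy₁β
  have hdist : ∀ t : IBondY x.toKIdx, (geo9Y x).dist y₁ t = (geo9Y x).dist y t := fun t => Node00.OpsYRead342.geo9K_dist_congr x.toKIdx hy₁β rfl
  set yL : IBondY x.toKIdx := ιB (β x.toKIdx.hN x.toKIdx.D x.toKIdx.hk y') with hyL
  have hdistL : (geo9Y x).dist y₁ yL = (geo9Y x).dist y y' := Node00.OpsYRead342.geo9K_dist_congr x.toKIdx hy₁β (hι _)
  have hleny₁ : 0 < (geo9Y x).len y₁ := geo9Y_len_pos x y₁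
  haveI : Nontrivial 𝔸 := NormOneClass.nontrivial
  obtain ⟨j₀⟩ := b.index_nonempty
  have hp₀ : blkC x.toKIdx ιB ((((0 : Fin (d + 1)), w₀), j₀) : (Fin (d + 1) × SiteY x.toKIdx) × ι).1.2 = y₁ := rfl
  -- geometry near the anchor: blocks within `< M` of `βy` have comparable lengths and shifted decay
  have hnear : ∀ (q : FBondY x.toKIdx) (r : ℝ), (geomT x.toKIdx.D).dist (blkV1 x.toKIdx.hN x.toKIdx.D q) (β x.toKIdx.hN x.toKIdx.D x.toKIdx.hk y) ≤ r →
      r < (geo9Y x).M →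
      (geo9Y x).len (ιB (blkV1 x.toKIdx.hN x.toKIdx.D q)) ≤ L * (geo9Y x).len y₁ ∧
      (geo9Y x).len y₁ ≤ L * (geo9Y x).len (ιB (blkV1 x.toKIdx.hN x.toKIdx.D q)) ∧
      ∀ y'' : IBondY x.toKIdx, Real.exp (-(δc * (geo9Y x).dist (ιB (blkV1 x.toKIdx.hN x.toKIdx.D q)) y'')) ≤
        Real.exp (δc * r) * Real.exp (-(δc * (geo9Y x).dist y₁ y'')) := by
    intro q r hq hr
    have hdq : (geo9Y x).dist (ιB (blkV1 x.toKIdx.hN x.toKIdx.D q)) y₁ = (geomT x.toKIdx.D).dist (blkV1 x.toKIdx.hN x.toKIdx.D q) (β x.toKIdx.hN x.toKIdx.D x.toKIdx.hk y) := by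
      show (geomT x.toKIdx.D).dist (β x.toKIdx.hN x.toKIdx.D x.toKIdx.hk (ιB _)) (β x.toKIdx.hN x.toKIdx.D x.toKIdx.hk y₁) = _
      rw [hι, hy₁β]
    have hlt : (geo9Y x).dist (ιB (blkV1 x.toKIdx.hN x.toKIdx.D q)) y₁ < (geo9Y x).M := by rw [hdq]; exact lt_of_le_of_lt hq hr
    have hlt' : (geo9Y x).dist y₁ (ιB (blkV1 x.toKIdx.hN x.toKIdx.D q)) < (geo9Y x).M := by rw [geo9Y_dist_comm]; exact hlt
    refine ⟨len_le_of_dist_lt_M_geo9K x.toKIdx hlt, len_le_of_dist_lt_M_geo9K x.toKIdx hlt', fun y'' => ?_⟩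
    rw [← Real.exp_add]
    refine Real.exp_le_exp.2 ?_
    have ht := geo9Y_dist_triangle x y₁ (ιB (blkV1 x.toKIdx.hN x.toKIdx.D q)) y''
    rw [geo9Y_dist_comm x y₁ (ιB _), hdq] at ht
    nlinarith [hdn (ιB (blkV1 x.toKIdx.hN x.toKIdx.D q)) y'']
  -- constants
  set cζ : ℝ := (geo9Y x).cutH α (Sum.inr z) with hcζ
  have hcζ0 : 0 ≤ cζ := hcutH
  set Bp : ℝ := max (Bβ α) 0 with hBp
  have hBp0 : 0 ≤ Bp := le_max_right _ _
  set BhL : ℝ := Sb * Bp with hBhL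
  have hBhL0 : 0 ≤ BhL := mul_nonneg hSb0 hBp0
  set BhA : ℝ := Sb * (M₂ * Sb * B₀) * (L ^ 3 * Real.exp δc + cLip * L ^ 2 * Real.exp (δc * (rL + 1))) with hBhA
  have hBhA0 : 0 ≤ BhA := by positivity
  set BhX : ℝ := Sb * Bp * (1 + (mN : ℝ) * (M₂ * Sb) * Real.exp (δc * (2 * ((d : ℝ) + 1)))) with hBhX
  have hBhX0 : 0 ≤ BhX := by positivity
  set BhR : ℝ := BhX + BhA with hBhR
  have hBhR0 : 0 ≤ BhR := add_nonneg hBhX0 hBhA0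
  -- the (3.43) block at the base, READ: reading bounds for scalar inputs supported in a block, at the call rate δc
  set Wf : IBondY x.toKIdx → ℝ := fun a' => Bp * (geo9Y x).len y₁ ^ (1 - α) * cζ * Real.exp (-(δc * (geo9Y x).dist y₁ a')) with hWf
  have hWf0 : ∀ a', 0 ≤ Wf a' := fun a' =>
    mul_nonneg (mul_nonneg (mul_nonneg hBp0 (Real.rpow_nonneg hleny₁.le _)) hcζ0) (Real.exp_pos _).le
  have hreadU : ∀ (g : FBondY x.toKIdx → ℝ) (a' : IBondY x.toKIdx), (geo9Y x).suppIn (Sum.inr g) a' →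
      h1ReadB x.toKIdx TU (parB U) U g α z ≤ Wf a' * (geo9Y x).supNorm (Sum.inr g) := by
    intro g a' hg
    have h := hH1 α (Sum.inr g) (Sum.inr z) y a' hα0 hα1 hζ hg
    rw [KACU_h1_inr_eq] at h
    have hN : 0 ≤ (geo9Y x).supNorm (Sum.inr g) := (modelSignsOn_geo9K x.toKIdx).supNorm_nonneg _
    refine (show h1ReadB x.toKIdx TU (parB U) U g α z ≤ _ from h).trans ?_
    rw [← hlen, ← hdist]
    have hP : 0 ≤ (geo9Y x).len y₁ ^ (1 - α) * cζ := mul_nonneg (Real.rpow_nonneg hleny₁.le _) hcζ0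
    have hexp : Real.exp (-(δ * (geo9Y x).dist y₁ a')) ≤ Real.exp (-(δc * (geo9Y x).dist y₁ a')) :=
      Real.exp_le_exp.2 (by nlinarith [hdn y₁ a'])
    calc Bβ α * (geo9Y x).len y₁ ^ (1 - α) * (geo9Y x).cutH α (Sum.inr z) * Real.exp (-(δ * (geo9Y x).dist y₁ a')) *
          (geo9Y x).supNorm (Sum.inr g)
        = Bβ α * (((geo9Y x).len y₁ ^ (1 - α) * cζ) * Real.exp (-(δ * (geo9Y x).dist y₁ a')) * (geo9Y x).supNorm (Sum.inr g)) := by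
          rw [hcζ]; ring
      _ ≤ Bp * (((geo9Y x).len y₁ ^ (1 - α) * cζ) * Real.exp (-(δc * (geo9Y x).dist y₁ a')) * (geo9Y x).supNorm (Sum.inr g)) := by
          refine mul_le_mul (le_max_left _ _) ?_ (mul_nonneg (mul_nonneg hP (Real.exp_pos _).le) hN) hBp0
          exact mul_le_mul_of_nonneg_right (mul_le_mul_of_nonneg_left hexp hP) hN
      _ = Wf a' * (geo9Y x).supNorm (Sum.inr g) := by rw [hWf]; ring
  -- the block support of the coordinates of the output input `J ⊗ E`
  have hBS : ∀ {E : 𝔸}, ‖E‖ ≤ 1 → BlockSupp (g := toB6 (geo9Y x) (0 : ℝ) True) (fun q : (Fin (d + 1) × SiteY x.toKIdx) × ι => blkC x.toKIdx ιB q.1.2)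
      (coordEquiv b (bondFunCoordsY x.toKIdx (liftY J E))) yL (M₂ * (geo9Y x).supNorm (Sum.inr J)) := fun hE1 =>
    blockSupp_coordEquiv_bondFun_liftY x.toKIdx b ιB hM₂ hrepr J y' hlam hE1
  ------------------------------------------------------------------
  -- LEFT WORDS: `∇_{U,ν}G(U′U)(J ⊗ E)`
  ------------------------------------------------------------------
  have hLeft : ∀ (E : BallY 𝔸) (ν : Fin (d + 1)) (q q' : FBondY x.toKIdx), Adm x.toKIdx q q' →
      ‖probeB x.toKIdx (parB U) α z q q' (cdB x.toKIdx U ν (TW (liftY J (E : 𝔸))))‖ ≤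
        B * BhL * (geo9Y x).len y₁ ^ (1 - α) * cζ * Real.exp (-(δc / 6 * (geo9Y x).dist y₁ yL)) * (M₂ * (geo9Y x).supNorm (Sum.inr J)) := by
    intro E ν q q' hadm
    have hE1 : ‖(E : 𝔸)‖ ≤ 1 := mem_closedBall_zero_iff.1 E.2
    set D : Module.End ℝ ((Fin (d + 1) × SiteY x.toKIdx) × ι → ℝ) := conj b (bondOpCoordsRY x.toKIdx (cdBₗ x.toKIdx U ν)) with hD
    set Φ : (Fin (d + 1) × SiteY x.toKIdx → 𝔸) →ₗ[ℝ] 𝔸 := probeBC x.toKIdx (parB U) α z q q' with hΦ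
    -- the premise at the base
    have prem : ∀ (y'' : IBondY x.toKIdx) (μ : (Fin (d + 1) × SiteY x.toKIdx) × ι → ℝ) (M : ℝ),
        BlockSupp (g := toB6 (geo9Y x) (0 : ℝ) True) (fun q : (Fin (d + 1) × SiteY x.toKIdx) × ι => blkC x.toKIdx ιB q.1.2) μ y'' M →
        ‖Φ ((coordEquiv b).symm (D (GbQC x.toKIdx 𝔮 𝔮s par b (.base U) μ)))‖ ≤
          BhL * (geo9Y x).len y₁ ^ (1 - α) * cζ * Real.exp (-(δc * (geo9Y x).dist y₁ y'')) * M := by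
      intro y'' μ M hμ
      calc ‖Φ ((coordEquiv b).symm (D (GbQC x.toKIdx 𝔮 𝔮s par b (.base U) μ)))‖
          = ‖probeB x.toKIdx (parB U) α z q q' (cdB x.toKIdx U ν (TU (lamB x.toKIdx b μ)))‖ := by
            rw [hΦ, probeBC_symm, ← Module.End.mul_apply, hD, lamB_DL_GbQC, decY_base]
        _ ≤ Sb * (Wf y'' * M) := probeL_lamB_le x.toKIdx b ιB TU (parB U) U hι hM₂ hrepr α z hWf0 hreadU hμ ν hadm
        _ = BhL * (geo9Y x).len y₁ ^ (1 - α) * cζ * Real.exp (-(δc * (geo9Y x).dist y₁ y'')) * M := by rw [hWf, hBhL]; ring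
    have concl := HL D Φ y₁ _ hp₀ α BhL cζ hBhL0 hcζ0 prem yL (coordEquiv b (bondFunCoordsY x.toKIdx (liftY J (E : 𝔸)))) _ (hBS hE1)
    calc ‖probeB x.toKIdx (parB U) α z q q' (cdB x.toKIdx U ν (TW (liftY J (E : 𝔸))))‖
        = ‖Φ ((coordEquiv b).symm (D (GbQC x.toKIdx 𝔮 𝔮s par b ((codingYx P G x C37 C38).bg.mul (.mult a) (.base U))
            (coordEquiv b (bondFunCoordsY x.toKIdx (liftY J (E : 𝔸)))))))‖ := by
          rw [hΦ, probeBC_symm, ← Module.End.mul_apply, hD, lamB_DL_GbQC, lamB_coordEquiv_bondFunCoordsY]; rfl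
      _ ≤ _ := concl
  ------------------------------------------------------------------
  -- RIGHT WORDS: `G(U′U)∇*_{U,ν}(J ⊗ E)`
  ------------------------------------------------------------------
  have hRight : ∀ (E : BallY 𝔸) (ν : Fin (d + 1)) (q q' : FBondY x.toKIdx), Adm x.toKIdx q q' →
      ‖probeB x.toKIdx (parB U) α z q q' (TW (cdsB x.toKIdx U ν (liftY J (E : 𝔸))))‖ ≤
        B * BhR * (geo9Y x).len y₁ ^ (1 - α) * cζ * Real.exp (-(δc / 6 * (geo9Y x).dist y₁ yL)) * (M₂ * (geo9Y x).supNorm (Sum.inr J)) := by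
    intro E ν q q' hadm
    have hE1 : ‖(E : 𝔸)‖ ≤ 1 := mem_closedBall_zero_iff.1 E.2
    set Ds : Module.End ℝ ((Fin (d + 1) × SiteY x.toKIdx) × ι → ℝ) := conj b (bondOpCoordsRY x.toKIdx (cdsBₗ x.toKIdx U ν)) with hDs
    set Φ : (Fin (d + 1) × SiteY x.toKIdx → 𝔸) →ₗ[ℝ] 𝔸 := probeBC x.toKIdx (parB U) α z q q' with hΦ
    have hfac1 : ∀ (y'' : IBondY x.toKIdx) (M : ℝ), 0 ≤ M → 0 ≤ (geo9Y x).len y₁ ^ (1 - α) * cζ * Real.exp (-(δc * (geo9Y x).dist y₁ y'')) * M :=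
      fun y'' M hM => mul_nonneg (mul_nonneg (mul_nonneg (Real.rpow_nonneg hleny₁.le _) hcζ0) (Real.exp_pos _).le) hM
    -- (1) the right-word premise at a backward letter (shared by (b′)-inr and (c′))
    have hbinr : ∀ (ν' : Fin (d + 1)) (y'' : IBondY x.toKIdx) (μ : (Fin (d + 1) × SiteY x.toKIdx) × ι → ℝ) (M : ℝ),
        BlockSupp (g := toB6 (geo9Y x) (0 : ℝ) True) (fun q : (Fin (d + 1) × SiteY x.toKIdx) × ι => blkC x.toKIdx ιB q.1.2) μ y'' M →
        ‖Φ ((coordEquiv b).symm ((GbQC x.toKIdx 𝔮 𝔮s par b (.base U) * conj b (bondOpCoordsRY x.toKIdx (cdsBₗ x.toKIdx U ν'))) μ))‖ ≤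
          BhR * (geo9Y x).len y₁ ^ (1 - α) * cζ * Real.exp (-(δc * (geo9Y x).dist y₁ y'')) * M := by
      intro ν' y'' μ M hμ
      calc ‖Φ ((coordEquiv b).symm ((GbQC x.toKIdx 𝔮 𝔮s par b (.base U) * conj b (bondOpCoordsRY x.toKIdx (cdsBₗ x.toKIdx U ν'))) μ))‖
          = ‖probeB x.toKIdx (parB U) α z q q' (TU (cdsB x.toKIdx U ν' (lamB x.toKIdx b μ)))‖ := by
            rw [hΦ, probeBC_symm, lamB_GbQC_DR, decY_base]
        _ ≤ Sb * (Wf y'' * M) := probeR_lamB_le x.toKIdx b ιB TU (parB U) U hι hM₂ hrepr α z hWf0 hreadU hμ ν' hadm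
        _ = (Sb * Bp) * ((geo9Y x).len y₁ ^ (1 - α) * cζ * Real.exp (-(δc * (geo9Y x).dist y₁ y'')) * M) := by rw [hWf]; ring
        _ ≤ BhR * ((geo9Y x).len y₁ ^ (1 - α) * cζ * Real.exp (-(δc * (geo9Y x).dist y₁ y'')) * M) := by
            refine mul_le_mul_of_nonneg_right ?_ (hfac1 y'' M hμ.nonneg)
            rw [hBhR, hBhX]
            have h2 : Sb * Bp ≤ Sb * Bp * (1 + (mN : ℝ) * (M₂ * Sb) * Real.exp (δc * (2 * ((d : ℝ) + 1)))) :=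
              le_mul_of_one_le_right hBhL0 (le_add_of_nonneg_right (by positivity))
            linarith
        _ = BhR * (geo9Y x).len y₁ ^ (1 - α) * cζ * Real.exp (-(δc * (geo9Y x).dist y₁ y'')) * M := by ring
    -- (2) premise (a′): the undifferentiated probe (`probeB_undiff_le` with the (3.42) majorants, the law and the level comparability)
    have prema : ∀ (y'' : IBondY x.toKIdx) (μ : (Fin (d + 1) × SiteY x.toKIdx) × ι → ℝ) (M : ℝ),
        BlockSupp (g := toB6 (geo9Y x) (0 : ℝ) True) (fun q : (Fin (d + 1) × SiteY x.toKIdx) × ι => blkC x.toKIdx ιB q.1.2) μ y'' M →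
        ‖Φ ((coordEquiv b).symm (GbQC x.toKIdx 𝔮 𝔮s par b (.base U) μ))‖ ≤
          BhR * (geo9Y x).len y₁ ^ (2 - α) * cζ * Real.exp (-(δc * (geo9Y x).dist y₁ y'')) * M := by
      intro y'' μ M hμ
      have hM0 : 0 ≤ M := hμ.nonneg
      set Ed : ℝ := Real.exp (-(δc * (geo9Y x).dist y₁ y'')) with hEd
      have hEd0 : 0 < Ed := Real.exp_pos _
      set Ψ : FBondY x.toKIdx → 𝔸 := TU (lamB x.toKIdx b μ) with hΨ
      -- values of Ψ and of its covariant differences near `βy`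
      set A₀ : ℝ := Sb * (M₂ * Sb * B₀ * (L * (geo9Y x).len y₁) ^ 2 * (Real.exp (δc * 1) * Ed) * M) with hA₀
      have hA₀0 : 0 ≤ A₀ := by positivity
      set A₁ : ℝ := Sb * (M₂ * Sb * B₀ * (L * (geo9Y x).len y₁) * (Real.exp (δc * (rL + 1)) * Ed) * M) with hA₁
      have hA₁0 : 0 ≤ A₁ := by positivity
      have h0 : ∀ q' : FBondY x.toKIdx, (geomT x.toKIdx.D).dist (blkV1 x.toKIdx.hN x.toKIdx.D q') (β x.toKIdx.hN x.toKIdx.D x.toKIdx.hk y) ≤ 1 → ‖Ψ q'‖ ≤ A₀ := by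
        intro q' hq'
        obtain ⟨hl1, -, hex⟩ := hnear q' 1 hq' hM1
        have hv := norm_lamB_le_of_hasMajorant x.toKIdx b ιB hm0 hμ q'
        rw [lamB_conj_bondOpCoordsRY] at hv
        refine (show ‖Ψ q'‖ ≤ _ from hv).trans ?_
        rw [hA₀]
        refine mul_le_mul_of_nonneg_left ?_ hSb0
        have hl2 : (geo9Y x).len (ιB (blkV1 x.toKIdx.hN x.toKIdx.D q')) ^ 2 ≤ (L * (geo9Y x).len y₁) ^ 2 :=
          pow_le_pow_left₀ (geo9Y_len_pos x _).le hl1 2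
        have hstep : M₂ * Sb * B₀ * (geo9Y x).len (ιB (blkV1 x.toKIdx.hN x.toKIdx.D q')) ^ 2 *
              Real.exp (-(δc * (geo9Y x).dist (ιB (blkV1 x.toKIdx.hN x.toKIdx.D q')) y'')) * M
            ≤ M₂ * Sb * B₀ * (L * (geo9Y x).len y₁) ^ 2 * (Real.exp (δc * 1) * Ed) * M :=
          mul_le_mul (mul_le_mul (mul_le_mul_of_nonneg_left hl2 hcB) (hex y'') (Real.exp_pos _).le (by positivity)) le_rfl hM0 (by positivity)
        exact hstep
      have h1 : ∀ (q' : FBondY x.toKIdx) (μ' : Fin (d + 1)),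
          (geomT x.toKIdx.D).dist (blkV1 x.toKIdx.hN x.toKIdx.D q') (β x.toKIdx.hN x.toKIdx.D x.toKIdx.hk y) ≤ rL + 1 → ‖cdB x.toKIdx U μ' Ψ q'‖ ≤ A₁ := by
        intro q' μ' hq'
        obtain ⟨hl1, -, hex⟩ := hnear q' (rL + 1) hq' hMgeo
        have hv := norm_lamB_le_of_hasMajorant x.toKIdx b ιB (hm1 μ') hμ q'
        rw [lamB_conj_bondOpCoordsRY] at hv
        refine (show ‖cdB x.toKIdx U μ' Ψ q'‖ ≤ _ from hv).trans ?_
        rw [hA₁]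
        refine mul_le_mul_of_nonneg_left ?_ hSb0
        have hstep : M₂ * Sb * B₀ * (geo9Y x).len (ιB (blkV1 x.toKIdx.hN x.toKIdx.D q')) *
              Real.exp (-(δc * (geo9Y x).dist (ιB (blkV1 x.toKIdx.hN x.toKIdx.D q')) y'')) * M
            ≤ M₂ * Sb * B₀ * (L * (geo9Y x).len y₁) * (Real.exp (δc * (rL + 1)) * Ed) * M :=
          mul_le_mul (mul_le_mul (mul_le_mul_of_nonneg_left hl1 hcB) (hex y'') (Real.exp_pos _).le (by positivity)) le_rfl hM0 (by positivity)
        exact hstep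
      -- the scale lengths of the blocks within 1 of `βy`
      have hlenq : ∀ q' : FBondY x.toKIdx, (geo9Y x).len (ιB (blkV1 x.toKIdx.hN x.toKIdx.D q')) = lenB x.toKIdx q' := by
        intro q'
        show (kGeo x.toKIdx).len (ιB (blkV1 x.toKIdx.hN x.toKIdx.D q')) = _
        rw [B6KLevelCensusIndexV1.len_eq, ← beta_level x.toKIdx.hN x.toKIdx.D x.toKIdx.hk hk1, div_eq_mul_inv, hι]
        rfl
      have hlo : ∀ q' : FBondY x.toKIdx, (geomT x.toKIdx.D).dist (blkV1 x.toKIdx.hN x.toKIdx.D q') (β x.toKIdx.hN x.toKIdx.D x.toKIdx.hk y) ≤ 1 →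
          (geo9Y x).len y₁ / L ≤ lenB x.toKIdx q' := by
        intro q' hq'
        obtain ⟨-, hl2, -⟩ := hnear q' 1 hq' hM1
        rw [← hlenq, div_le_iff₀ (lt_of_lt_of_le one_pos hL1)]
        linarith
      have hhi : ∀ q' : FBondY x.toKIdx, (geomT x.toKIdx.D).dist (blkV1 x.toKIdx.hN x.toKIdx.D q') (β x.toKIdx.hN x.toKIdx.D x.toKIdx.hk y) ≤ 1 →
          lenB x.toKIdx q' ≤ L * (geo9Y x).len y₁ := by
        intro q' hq'
        obtain ⟨hl1, -, -⟩ := hnear q' 1 hq' hM1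
        rw [← hlenq]; exact hl1
      have hLam0 : 0 < (geo9Y x).len y₁ / L := div_pos hleny₁ (lt_of_lt_of_le one_pos hL1)
      have hLam1 : 0 ≤ L * (geo9Y x).len y₁ := mul_nonneg hL0 hleny₁.le
      have hu := probeB_undiff_le x.toKIdx (parB U) U hcLip hLipU hparU hα0 hα1.le z y hζ' Ψ hA₀0 hA₁0 hLam0 hLam1 h0 h1 hlo hhi hadm
      have hbr : ‖Φ ((coordEquiv b).symm (GbQC x.toKIdx 𝔮 𝔮s par b (.base U) μ))‖ = ‖probeB x.toKIdx (parB U) α z q q' Ψ‖ := by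
        rw [hΦ, probeBC_symm, lamB_GbQC, decY_base]
      rw [hbr]
      refine hu.trans ?_
      -- arithmetic: `cζ·(Λ₀^{−α}A₀ + c_Lip Λ₁^{1−α} A₁) ≦ B_hA·ℓ^{2−α}·cζ·E″·M ≦ B_hR·…`
      have hP1 : ((geo9Y x).len y₁ / L) ^ (-α) * A₀ ≤ Sb * (M₂ * Sb * B₀) * (L ^ 3 * Real.exp δc) * ((geo9Y x).len y₁ ^ (2 - α) * Ed * M) := by
        have hr := div_rpow_neg_mul_sq_le hleny₁ hL1 hα1.le
        have hq : 0 ≤ Sb * (M₂ * Sb * B₀) * L ^ 2 * (Real.exp (δc * 1) * Ed) * M := by positivity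
        calc ((geo9Y x).len y₁ / L) ^ (-α) * A₀
            = (((geo9Y x).len y₁ / L) ^ (-α) * (geo9Y x).len y₁ ^ 2) * (Sb * (M₂ * Sb * B₀) * L ^ 2 * (Real.exp (δc * 1) * Ed) * M) := by
              rw [hA₀]; ring
          _ ≤ (L * (geo9Y x).len y₁ ^ (2 - α)) * (Sb * (M₂ * Sb * B₀) * L ^ 2 * (Real.exp (δc * 1) * Ed) * M) :=
              mul_le_mul_of_nonneg_right hr hq
          _ = Sb * (M₂ * Sb * B₀) * (L ^ 3 * Real.exp δc) * ((geo9Y x).len y₁ ^ (2 - α) * Ed * M) := by rw [mul_one]; ring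
      have hP2 : cLip * (L * (geo9Y x).len y₁) ^ (1 - α) * A₁ ≤
          Sb * (M₂ * Sb * B₀) * (cLip * L ^ 2 * Real.exp (δc * (rL + 1))) * ((geo9Y x).len y₁ ^ (2 - α) * Ed * M) := by
        have hr := mul_rpow_mul_le hleny₁ hL1 hα0
        have hq : 0 ≤ cLip * (Sb * (M₂ * Sb * B₀) * L * (Real.exp (δc * (rL + 1)) * Ed) * M) := by positivity
        calc cLip * (L * (geo9Y x).len y₁) ^ (1 - α) * A₁
            = ((L * (geo9Y x).len y₁) ^ (1 - α) * (geo9Y x).len y₁) * (cLip * (Sb * (M₂ * Sb * B₀) * L * (Real.exp (δc * (rL + 1)) * Ed) * M)) := by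
              rw [hA₁]; ring
          _ ≤ (L * (geo9Y x).len y₁ ^ (2 - α)) * (cLip * (Sb * (M₂ * Sb * B₀) * L * (Real.exp (δc * (rL + 1)) * Ed) * M)) :=
              mul_le_mul_of_nonneg_right hr hq
          _ = Sb * (M₂ * Sb * B₀) * (cLip * L ^ 2 * Real.exp (δc * (rL + 1))) * ((geo9Y x).len y₁ ^ (2 - α) * Ed * M) := by ring
      have hfac2 : 0 ≤ (geo9Y x).len y₁ ^ (2 - α) * Ed * M := mul_nonneg (mul_nonneg (Real.rpow_nonneg hleny₁.le _) hEd0.le) hM0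
      have hAle : BhA ≤ BhR := by rw [hBhR]; exact le_add_of_nonneg_left hBhX0
      calc (geo9Y x).cutH α (Sum.inr z) * (((geo9Y x).len y₁ / L) ^ (-α) * A₀ + cLip * (L * (geo9Y x).len y₁) ^ (1 - α) * A₁)
          ≤ cζ * (Sb * (M₂ * Sb * B₀) * (L ^ 3 * Real.exp δc) * ((geo9Y x).len y₁ ^ (2 - α) * Ed * M) +
              Sb * (M₂ * Sb * B₀) * (cLip * L ^ 2 * Real.exp (δc * (rL + 1))) * ((geo9Y x).len y₁ ^ (2 - α) * Ed * M)) := by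
            rw [← hcζ]; exact mul_le_mul_of_nonneg_left (add_le_add hP1 hP2) hcζ0
        _ = BhA * ((geo9Y x).len y₁ ^ (2 - α) * cζ * Ed * M) := by rw [hBhA]; ring
        _ ≤ BhR * ((geo9Y x).len y₁ ^ (2 - α) * cζ * Ed * M) :=
            mul_le_mul_of_nonneg_right hAle (mul_nonneg (mul_nonneg (mul_nonneg (Real.rpow_nonneg hleny₁.le _) hcζ0) hEd0.le) hM0)
        _ = BhR * (geo9Y x).len y₁ ^ (2 - α) * cζ * Real.exp (-(δc * (geo9Y x).dist y₁ y'')) * M := by rw [hEd]; ring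
    -- (3) premise (b′): every letter `∇♯_k` on the right of `G(U)` (forward letters through the CROSS read)
    have premb : ∀ (k : Fin (d + 1) ⊕ Fin (d + 1)) (y'' : IBondY x.toKIdx) (μ : (Fin (d + 1) × SiteY x.toKIdx) × ι → ℝ) (M : ℝ),
        BlockSupp (g := toB6 (geo9Y x) (0 : ℝ) True) (fun q : (Fin (d + 1) × SiteY x.toKIdx) × ι => blkC x.toKIdx ιB q.1.2) μ y'' M →
        ‖Φ ((coordEquiv b).symm ((GbQC x.toKIdx 𝔮 𝔮s par b (.base U) *
            conj b (diffLetter (bT (shiftY x.toKIdx)) (bU (coordC G x.toKIdx (.base U))) ((((geo9Y x).eta : ℂ))⁻¹) k)) μ))‖ ≤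
          BhR * (geo9Y x).len y₁ ^ (1 - α) * cζ * Real.exp (-(δc * (geo9Y x).dist y₁ y'')) * M := by
      intro k y'' μ M hμ
      rcases k with ν' | ν'
      · -- forward letter: the cross word
        rw [hDk, norm_map_symm_mul_diffLetter_inl, hΦ, probeBC_symm, lamB_GbQC_DF, decY_base]
        set W₀ : ℝ := Bp * (geo9Y x).len y₁ ^ (1 - α) * cζ * (Real.exp (δc * (2 * ((d : ℝ) + 1))) * Real.exp (-(δc * (geo9Y x).dist y₁ y''))) with hW₀
        have hWnbr : ∀ a' ∈ nbr (geo9Y x) (2 * ((d : ℝ) + 1)) y'', Wf a' ≤ W₀ := by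
          intro a' ha'
          have hda : (geo9Y x).dist a' y'' ≤ 2 * ((d : ℝ) + 1) := mem_nbr.1 ha'
          have htri' := geo9Y_dist_triangle x y₁ a' y''
          rw [hWf, hW₀]
          refine mul_le_mul_of_nonneg_left ?_ (mul_nonneg (mul_nonneg hBp0 (Real.rpow_nonneg hleny₁.le _)) hcζ0)
          rw [← Real.exp_add]
          exact Real.exp_le_exp.2 (by nlinarith)
        have h := probe_crossB_lamB_le x.toKIdx b ιB TU (parB U) U hι hM₂ hrepr hUu hnbrU α z y'' hWf0 hWnbr hreadU μ hμ ν' hadm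
        refine h.trans ?_
        have hle : Sb * (((mN : ℝ) * (M₂ * Sb) * W₀) * M) = (Sb * Bp * ((mN : ℝ) * (M₂ * Sb) * Real.exp (δc * (2 * ((d : ℝ) + 1))))) *
            ((geo9Y x).len y₁ ^ (1 - α) * cζ * Real.exp (-(δc * (geo9Y x).dist y₁ y'')) * M) := by rw [hW₀]; ring
        rw [hle]
        have hco2 : Sb * Bp * ((mN : ℝ) * (M₂ * Sb) * Real.exp (δc * (2 * ((d : ℝ) + 1)))) ≤ BhR := by
          rw [hBhR, hBhX]
          have : Sb * Bp * ((mN : ℝ) * (M₂ * Sb) * Real.exp (δc * (2 * ((d : ℝ) + 1)))) ≤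
              Sb * Bp * (1 + (mN : ℝ) * (M₂ * Sb) * Real.exp (δc * (2 * ((d : ℝ) + 1)))) :=
            mul_le_mul_of_nonneg_left (le_add_of_nonneg_left zero_le_one) hBhL0
          linarith
        calc (Sb * Bp * ((mN : ℝ) * (M₂ * Sb) * Real.exp (δc * (2 * ((d : ℝ) + 1))))) *
              ((geo9Y x).len y₁ ^ (1 - α) * cζ * Real.exp (-(δc * (geo9Y x).dist y₁ y'')) * M)
            ≤ BhR * ((geo9Y x).len y₁ ^ (1 - α) * cζ * Real.exp (-(δc * (geo9Y x).dist y₁ y'')) * M) :=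
              mul_le_mul_of_nonneg_right hco2 (hfac1 y'' M hμ.nonneg)
          _ = _ := by ring
      · -- backward letter: the printed right word
        rw [hDk, norm_map_symm_mul_diffLetter_inr]
        exact hbinr ν' y'' μ M hμ
    -- (4) premise (c′) and the conclusion of the right transfer
    have concl := HR Ds (hm2 ν) Φ y₁ _ hp₀ α BhR cζ hBhR0 hcζ0 prema premb (fun y'' μ M hμ => by rw [hDs]; exact hbinr ν y'' μ M hμ)
      yL (coordEquiv b (bondFunCoordsY x.toKIdx (liftY J (E : 𝔸)))) _ (hBS hE1)
    calc ‖probeB x.toKIdx (parB U) α z q q' (TW (cdsB x.toKIdx U ν (liftY J (E : 𝔸))))‖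
        = ‖Φ ((coordEquiv b).symm ((GbQC x.toKIdx 𝔮 𝔮s par b ((codingYx P G x C37 C38).bg.mul (.mult a) (.base U)) * Ds)
            (coordEquiv b (bondFunCoordsY x.toKIdx (liftY J (E : 𝔸))))))‖ := by
          rw [hΦ, probeBC_symm, hDs, lamB_GbQC_DR, lamB_coordEquiv_bondFunCoordsY]; rfl
      _ ≤ _ := concl
  ------------------------------------------------------------------
  -- WRITE the (3.43) block of the reading at the product
  ------------------------------------------------------------------
  have hfacN : 0 ≤ (geo9Y x).len y ^ (1 - α) * cζ * Real.exp (-(δc / 6 * (geo9Y x).dist y y')) * (geo9Y x).supNorm (Sum.inr J) :=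
    mul_nonneg (mul_nonneg (mul_nonneg (Real.rpow_nonneg hleny.le _) hcζ0) (Real.exp_pos _).le) hsupN
  have hfinal : ∀ {Bh : ℝ}, 0 ≤ Bh → M₂ * (B * Bh) ≤ W5 →
      B * Bh * (geo9Y x).len y₁ ^ (1 - α) * cζ * Real.exp (-(δc / 6 * (geo9Y x).dist y₁ yL)) * (M₂ * (geo9Y x).supNorm (Sum.inr J)) ≤
        W5 * (geo9Y x).len y ^ (1 - α) * (geo9Y x).cutH α (Sum.inr z) * Real.exp (-(δc / 6 * (geo9Y x).dist y y')) * (geo9Y x).supNorm (Sum.inr J) := by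
    intro Bh hBh hle
    rw [hlen, hdistL, ← hcζ]
    calc B * Bh * (geo9Y x).len y ^ (1 - α) * cζ * Real.exp (-(δc / 6 * (geo9Y x).dist y y')) * (M₂ * (geo9Y x).supNorm (Sum.inr J))
        = (M₂ * (B * Bh)) * ((geo9Y x).len y ^ (1 - α) * cζ * Real.exp (-(δc / 6 * (geo9Y x).dist y y')) * (geo9Y x).supNorm (Sum.inr J)) := by ring
      _ ≤ W5 * ((geo9Y x).len y ^ (1 - α) * cζ * Real.exp (-(δc / 6 * (geo9Y x).dist y y')) * (geo9Y x).supNorm (Sum.inr J)) :=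
          mul_le_mul_of_nonneg_right hle hfacN
      _ = _ := by ring
  have hwL : M₂ * (B * BhL) ≤ W5 := by
    rw [hW5def, wHG6, hBhL, ← hBp]
    have h1 : 0 ≤ Sb * Bp * (1 + (mN : ℝ) * (M₂ * Sb) * Real.exp (δc * (2 * ((d : ℝ) + 1)))) +
        Sb * (M₂ * Sb * B₀) * (L ^ 3 * Real.exp δc + cLip * L ^ 2 * Real.exp (δc * (rL + 1))) := by positivity
    have h2 : M₂ * (B * (Sb * Bp)) = M₂ * B * (Sb * Bp) := by ring
    rw [h2]
    exact mul_le_mul_of_nonneg_left (le_add_of_nonneg_right h1) (mul_nonneg hM₂ hB)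
  have hwR : M₂ * (B * BhR) ≤ W5 := by
    rw [hW5def, wHG6, hBhR, hBhX, hBhA, ← hBp]
    have h2 : M₂ * (B * (Sb * Bp * (1 + (mN : ℝ) * (M₂ * Sb) * Real.exp (δc * (2 * ((d : ℝ) + 1)))) +
        Sb * (M₂ * Sb * B₀) * (L ^ 3 * Real.exp δc + cLip * L ^ 2 * Real.exp (δc * (rL + 1))))) =
        M₂ * B * (Sb * Bp * (1 + (mN : ℝ) * (M₂ * Sb) * Real.exp (δc * (2 * ((d : ℝ) + 1)))) +
          Sb * (M₂ * Sb * B₀) * (L ^ 3 * Real.exp δc + cLip * L ^ 2 * Real.exp (δc * (rL + 1)))) := by ring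
    rw [h2]
    exact mul_le_mul_of_nonneg_left (le_add_of_nonneg_left hBhL0) (mul_nonneg hM₂ hB)
  exact h1ReadB_le_of_probes x.toKIdx TW (parB U) U J α z hRHS
    (fun E ν q q' hadm => (hLeft E ν q q' hadm).trans (hfinal hBhL0 hwL))
    (fun E ν q q' hadm => (hRight E ν q q' hadm).trans (hfinal hBhR0 hwR))

end Transfer

end Literature.MathematicalPhysics.QuantumFieldTheory.Balaban1983to89.B9SectBH1GTransferQY

end
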